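import Mathlib
import Literature.NumberTheory.Automorphic.StrongArtinGL2LocalRigidityProofs
import Summits.Langlands.Langlands.Theorems.SkinnerWilesDefectOneStrongLiftingAllFiniteLFactorRigidity

/-!
# The ramified clause of `StrongLiftingAllFinite` from the single-place identity, in the
# `s`-plane (Jacquet–Langlands' zero counting for `GL_n`): local rigidity of the Euler data
# (item stmt-Langlands-15194, route `SkinnerWilesDefectOne`)

Sibling of `…LFactorRigidity` / `…PrimeSeparation` / `…Certificate` (same kernel, same line).
The tree already proves Gelbart's Prop. 4.1 for `GL₂` by Jacquet–Langlands' argument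
(`StrongArtinGL2LocalRigidityProofs`, `…GlobalQuotientProofs`: the quotient of the functional
equations of `L(s, ω ⊗ π)` and `L(s, ω ⊗ σ)` for an idèle class character `ω` trivial at `v` and
highly ramified at the other exceptional places leaves a single-place identity; its zeros on the
vertical progressions of the Euler terms `1 - a q^{-s}` are compared, the `ε`- and `Γ`-quotients
vanishing only on finitely many horizontal lines).  THIS FILE is the `GL_n` local half of the same
argument for the RAMIFIED CLAUSE (R) of `StrongLiftingAllFinite`: at a place `v₀` of `F` ramified
in the cyclic prime-degree `E/F` (`f = 1`, one `w₀ ∣ v₀`, `q_{w₀} = q_{v₀} = q`) with `π_{v₀}`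
unramified of Satake parameter `α`, the single-place identity reads

  `Ψ(s) · ∏_{a ∈ α} (1 - a q^{-s}) · ∏_j (1 - u_j' q^{-(1-s)})
      = Φ(s) · ∏_j (1 - u_j q^{-s}) · ∏_{a ∈ α} (1 - a⁻¹ q^{-(1-s)})`        (`s ∉ E`)

(`L(s, π_{v₀})⁻¹ L(1-s, P̃_{w₀})⁻¹` against `L(s, P_{w₀})⁻¹ L(1-s, π̃_{v₀})⁻¹`; `L(s, π_{v₀} ⊗ η_{v₀}ⁱ) = 1`
for `i ≠ 0`, `η_{v₀}` being ramified; `(u_j, m_j)` the Euler data of the blocks `St_{m_j}(χ_j)`,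
`χ_j` unramified, of the generic `P_{w₀}`, `u_j' = u_j⁻¹ q^{-(m_j-1)}`), with `Φ, Ψ` continuous and
`Φ` non-vanishing off a closed `E` meeting every vertical progression of Euler zeros finitely.
We prove that it forces every `m_j = 1` and `α = {u_j}` — `P_{w₀}` is the irreducible unramified
principal series with `t_{P,w₀} = α`, clause (R) — with NO condition on the other bad places (they
are killed by `ω`), NO archimedean matching and NO prime separation:

* `blocks_trivial_of_multiset_eq` — the multiset form of `blocks_trivial_of_prod_eq`
  (`…LFactorRigidity`): `α + {u_j q^{m_j}} = q•α + {u_j}` and genericity force the conclusion.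
* `multiset_eq_of_eulerTerm_identity` — **peeling** (Jacquet–Langlands p. 211 / Deligne–Serre
  Lemma 4.9 for any number of roots): `Ψ ∏_{z ∈ A}(1 - z q^{-s}) = Φ ∏_{z ∈ B}(1 - z q^{-s})` off
  `E`, `card B ≤ card A`, forces `B = A` (`mem_of_eulerTerm_identity`, `eq_of_eulerTerm_mul_eq` of
  the `GL₂` file, inductively).
* `one_sub_mul_cpow_neg_one_sub` — a dual term is an Euler term up to a unit:
  `1 - c q^{-(1-s)} = -(c/q) q^{s} (1 - (q/c) q^{-s})`; so the dual factors of `P̃_{w₀}` carry the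
  roots `u_j q^{m_j}` and those of `π̃_{v₀}` the roots `q a`.
* `ramifiedClause_of_local_identity` — the displayed identity forces `(∀ j, m_j = 1) ∧ α = {u_j}`.

Helper for the item (does not close it): the GLOBAL half — the analytic package of the twisted
standard `L`-functions of `P ⊗ (ω ∘ N)` and `π ⊗ ω ⊗ ηⁱ` with the Jacquet–Piatetski-Shapiro–
Shalika local factors at `w₀` (the `GL_n` analogue of the tree's named fact
`JacquetLanglands1970_twistedCuspidalPackage`) — is NOT asserted here.

## References

* H. Jacquet, R. P. Langlands, *Automorphic Forms on GL(2)*, LNM 114 (1970), proof of Thm. 12.2,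
  pp. 209–211, Lemma 12.5. [JacquetLanglands1970]
* P. Deligne, J.-P. Serre, *Formes modulaires de poids 1*, Ann. Sci. ÉNS 7 (1974), Lemma 4.9.
  [DeligneSerreASENS1974]
* J. Arthur, L. Clozel, Ann. of Math. Stud. 120 (1989), Ch. 3, Thm. 5.1. [ArthurClozelAMS120]
-/

set_option linter.dupNamespace false -- project-wide option (lakefile weak.linter.dupNamespace); `Summit.Langlands.Langlands` is the mandated namespace

noncomputable section

open Polynomial Finset Complex
open Literature.NumberTheory.LFunctions Literature.NumberTheory.Automorphic

namespace Summit.Langlands.Langlands.Theorems.SkinnerWilesDefectOne.StrongLiftingAllFinite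

/-! ### The multiset form of the single-prime rigidity -/

section Blocks

variable {ι : Type*} [Fintype ι]

/-- **Clause (R) from the multiset identity and genericity** (multiset form of
`blocks_trivial_of_prod_eq`): if `α + {u_i q^{m_i}} = q•α + {u_i}` with `1 < ‖q‖`, entries of `α`
and the `u_i` non-zero, `m_i ≥ 1`, and no two entries of `α` have ratio `q`, then every `m_i = 1`
and `α = {u_i}_i`. [folklore] -/
theorem blocks_trivial_of_multiset_eq {q : ℂ} (hq : 1 < ‖q‖) {α : Multiset ℂ}
    (hα : (0 : ℂ) ∉ α) (hgen : ∀ a ∈ α, ∀ b ∈ α, b ≠ q * a) (u : ι → ℂ) (m : ι → ℕ)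
    (hu : ∀ i, u i ≠ 0) (hm : ∀ i, 1 ≤ m i)
    (h : α + ∑ i, ({u i * q ^ m i} : Multiset ℂ) = α.map (q * ·) + ∑ i, ({u i} : Multiset ℂ)) :
    (∀ i, m i = 1) ∧ α = ∑ i, ({u i} : Multiset ℂ) := by
  have hαB := satake_eq_chains_of_multiset_eq hq hα u m hu h
  have hmem : ∀ i, ∀ t < m i, u i * q ^ t ∈ α := by
    intro i t ht
    rw [hαB]
    exact Multiset.mem_sum.mpr ⟨i, Finset.mem_univ i,
      Multiset.mem_map.mpr ⟨t, Multiset.mem_range.mpr ht, rfl⟩⟩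
  have hm1 : ∀ i, m i = 1 := by
    intro i
    by_contra hne
    have h0 : u i * q ^ 0 ∈ α := hmem i 0 (by have := hm i; omega)
    have h1 : u i * q ^ 1 ∈ α := hmem i 1 (by have := hm i; omega)
    exact hgen _ h0 _ h1 (by ring)
  refine ⟨hm1, ?_⟩
  rw [hαB]
  exact Finset.sum_congr rfl fun i _ => by simp [hm1 i]

/-- A product of Euler terms over a sum of singletons. [folklore] -/
theorem prod_map_sum_singleton_eulerTerm (q : ℕ) (g : ι → ℂ) (s : ℂ) :
    ((∑ i, ({g i} : Multiset ℂ)).map fun z => eulerTerm q z s).prod = ∏ i, eulerTerm q (g i) s := by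
  have hms : ((∑ i, ({g i} : Multiset ℂ)).map fun z => eulerTerm q z s) =
      ∑ i, ({g i} : Multiset ℂ).map fun z => eulerTerm q z s :=
    map_sum (Multiset.mapAddMonoidHom fun z => eulerTerm q z s) _ _
  rw [hms, Multiset.prod_sum]
  simp

end Blocks

/-! ### Peeling: an identity between products of Euler terms at one prime is rigid -/

section Peeling

variable {q : ℕ}

/-- **Peeling** (Jacquet–Langlands 1970, p. 211; Deligne–Serre 1974, Lemma 4.9 — for any number
of roots).  Let `q > 1`, `A`, `B` multisets of complex numbers with `0 ∉ A` and `card B ≤ card A`,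
`E ⊆ ℂ` closed and meeting the zero set of each `1 - z q^{-s}`, `z ∈ A`, in finitely many points,
`Φ, Ψ` continuous off `E` with `Φ` non-vanishing off `E`, and suppose
`Ψ(s) ∏_{z ∈ A} (1 - z q^{-s}) = Φ(s) ∏_{z ∈ B} (1 - z q^{-s})` for all `s ∉ E`.  Then `B = A`.
Proof: induction on `A`; a root `z` of `A` lies in `B` (`mem_of_eulerTerm_identity`: at a zero of
`1 - z q^{-s}` off `E` some factor on the right vanishes, with the same root), and the common
Euler term cancels (`eq_of_eulerTerm_mul_eq`, density of the complement of its zero set).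
[cite: JacquetLanglands1970, proof of Thm. 12.2, p. 211] -/
theorem multiset_eq_of_eulerTerm_identity (hq : 1 < q) {E : Set ℂ} (hEc : IsClosed E)
    {Φ : ℂ → ℂ} (hΦc : ContinuousOn Φ Eᶜ) (hΦ : ∀ s, s ∉ E → Φ s ≠ 0) :
    ∀ (A B : Multiset ℂ) (Ψ : ℂ → ℂ), (0 : ℂ) ∉ A → Multiset.card B ≤ Multiset.card A →
      (∀ z ∈ A, {s | s ∈ E ∧ eulerTerm q z s = 0}.Finite) → ContinuousOn Ψ Eᶜ →
      (∀ s, s ∉ E → Ψ s * (A.map fun z => eulerTerm q z s).prod =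
        Φ s * (B.map fun z => eulerTerm q z s).prod) → B = A := by
  have hq0 : q ≠ 0 := by omega
  intro A
  induction A using Multiset.induction_on with
  | empty =>
    intro B Ψ _ hcard _ _ _
    exact Multiset.card_eq_zero.mp (Nat.le_zero.mp (by simpa using hcard))
  | cons z A ih =>
    intro B Ψ h0 hcard hfin hΨc hid
    have hz0 : z ≠ 0 := fun h => h0 (h ▸ Multiset.mem_cons_self _ _)
    -- Step 1: `z ∈ B`
    have hmem : z ∈ B :=
      mem_of_eulerTerm_identity hq hz0 (hfin z (Multiset.mem_cons_self _ _)) hΦ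
        (L := fun s => Ψ s * (A.map fun z => eulerTerm q z s).prod)
        (fun s hs => by rw [← hid s hs, Multiset.map_cons, Multiset.prod_cons]; ring)
    obtain ⟨B', rfl⟩ := Multiset.exists_cons_of_mem hmem
    -- Step 2: cancel `1 - z q^{-s}`
    have hid' : ∀ s, s ∉ E → Ψ s * (A.map fun z => eulerTerm q z s).prod =
        Φ s * (B'.map fun z => eulerTerm q z s).prod := by
      refine eq_of_eulerTerm_mul_eq hq z hEc
        (hΨc.mul (continuous_multiset_prod_eulerTerm hq0 A).continuousOn)
        (hΦc.mul (continuous_multiset_prod_eulerTerm hq0 B').continuousOn) fun s hs => ?_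
      have h := hid s hs
      rw [Multiset.map_cons, Multiset.prod_cons, Multiset.map_cons, Multiset.prod_cons] at h
      linear_combination h
    -- Step 3: induction
    have hA0 : (0 : ℂ) ∉ A := fun h => h0 (Multiset.mem_cons_of_mem h)
    have hcard' : Multiset.card B' ≤ Multiset.card A := by
      simp only [Multiset.card_cons] at hcard
      omega
    rw [ih B' Ψ hA0 hcard' (fun z' hz' => hfin z' (Multiset.mem_cons_of_mem hz')) hΨc hid']

/-- **A dual term is an Euler term up to a unit**: for `c ≠ 0` and `q > 0`,
`1 - c q^{-(1-s)} = (-(c/q) q^{s}) · (1 - (q/c) q^{-s})`.  So `L(1 - s, χ⁻¹)⁻¹`-type factors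
`1 - c q^{-(1-s)}` have their zeros on the vertical progression of the Euler term with root `q/c`.
[folklore] -/
theorem one_sub_mul_cpow_neg_one_sub (hq : 0 < q) {c : ℂ} (hc : c ≠ 0) (s : ℂ) :
    1 - c * (q : ℂ) ^ (-(1 - s)) = (-(c / q) * (q : ℂ) ^ s) * eulerTerm q (q / c) s := by
  have hq0 : (q : ℂ) ≠ 0 := Nat.cast_ne_zero.mpr hq.ne'
  have hqs : (q : ℂ) ^ s ≠ 0 := fun h => hq0 ((cpow_eq_zero_iff _ _).mp h).1
  rw [eulerTerm_def, neg_sub, cpow_sub _ _ hq0, cpow_one, cpow_neg]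
  field_simp
  ring

/-- The unit in `one_sub_mul_cpow_neg_one_sub` is continuous and nowhere zero. [folklore] -/
theorem continuous_neg_div_mul_cpow (hq : 0 < q) (c : ℂ) :
    Continuous fun s : ℂ => -(c / q) * (q : ℂ) ^ s :=
  continuous_const.mul (continuous_id.const_cpow (Or.inl (Nat.cast_ne_zero.mpr hq.ne')))

/-- The unit in `one_sub_mul_cpow_neg_one_sub` is nowhere zero. [folklore] -/
theorem neg_div_mul_cpow_ne_zero (hq : 0 < q) {c : ℂ} (hc : c ≠ 0) (s : ℂ) :
    -(c / q) * (q : ℂ) ^ s ≠ 0 := by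
  have hq0 : (q : ℂ) ≠ 0 := Nat.cast_ne_zero.mpr hq.ne'
  exact mul_ne_zero (neg_ne_zero.mpr (div_ne_zero hc hq0))
    fun h => hq0 ((cpow_eq_zero_iff _ _).mp h).1

end Peeling

/-! ### Clause (R) from the single-place identity -/

section RamifiedClause

variable {q : ℕ} {ι : Type*} [Fintype ι]

/-- **The ramified clause from the single-place identity** (the `GL_n` analogue of
`frobSatake_of_local_identity`).  Let `q > 1`; `α` a multiset of non-zero complex numbers no two of
which have ratio `q` (the Satake parameter of the generic spherical `π_{v₀}`); blocks `(u_i, m_i)`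
with `u_i ≠ 0`, `m_i ≥ 1` (the Euler data of the lift at `w₀`, `L(s, P_{w₀})⁻¹ = ∏ (1 - u_i q^{-s})`,
`L(s, P̃_{w₀})⁻¹ = ∏ (1 - u_i⁻¹ q^{-(m_i-1)} q^{-s})`); `E ⊆ ℂ` closed, meeting every vertical
progression of Euler zeros finitely; `Φ, Ψ` continuous off `E`, `Φ` non-vanishing off `E`; and
`Ψ(s) ∏_{a ∈ α}(1 - a q^{-s}) ∏_i (1 - u_i⁻¹ q^{-(m_i-1)} q^{-(1-s)}) =
 Φ(s) ∏_i (1 - u_i q^{-s}) ∏_{a ∈ α} (1 - a⁻¹ q^{-(1-s)})` for `s ∉ E`.  Then every `m_i = 1` and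
`α = {u_i}_i`: the lift is unramified at `w₀` with `t_{P,w₀} = α`.  Proof: rewrite the dual terms as
units times Euler terms with roots `u_i q^{m_i}` and `q a` (`one_sub_mul_cpow_neg_one_sub`), peel
(`multiset_eq_of_eulerTerm_identity`) to get `{u_i} + q•α = α + {u_i q^{m_i}}`, and conclude by
`blocks_trivial_of_multiset_eq`. [cite: JacquetLanglands1970, proof of Thm. 12.2, pp. 210–211] -/
theorem ramifiedClause_of_local_identity (hq : 1 < q) {α : Multiset ℂ} (hα : (0 : ℂ) ∉ α)
    (hgen : ∀ a ∈ α, ∀ b ∈ α, b ≠ (q : ℂ) * a) (u : ι → ℂ) (m : ι → ℕ) (hu : ∀ i, u i ≠ 0)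
    (hm : ∀ i, 1 ≤ m i) {E : Set ℂ} (hEc : IsClosed E)
    (hEfin : ∀ z : ℂ, z ≠ 0 → {s | s ∈ E ∧ eulerTerm q z s = 0}.Finite)
    {Φ Ψ : ℂ → ℂ} (hΦc : ContinuousOn Φ Eᶜ) (hΨc : ContinuousOn Ψ Eᶜ)
    (hΦ : ∀ s, s ∉ E → Φ s ≠ 0)
    (hid : ∀ s, s ∉ E →
      Ψ s * (α.map fun a => eulerTerm q a s).prod *
          ∏ i, (1 - (u i)⁻¹ * ((q : ℂ)⁻¹) ^ (m i - 1) * (q : ℂ) ^ (-(1 - s))) =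
        Φ s * (∏ i, eulerTerm q (u i) s) *
          (α.map fun a => 1 - a⁻¹ * (q : ℂ) ^ (-(1 - s))).prod) :
    (∀ i, m i = 1) ∧ α = ∑ i, ({u i} : Multiset ℂ) := by
  classical
  have hqpos : 0 < q := lt_trans zero_lt_one hq
  have hq0 : (q : ℂ) ≠ 0 := Nat.cast_ne_zero.mpr hqpos.ne'
  have hq1 : 1 < ‖(q : ℂ)‖ := by
    rw [norm_natCast]
    exact_mod_cast hq
  have ha0 : ∀ a ∈ α, a ≠ 0 := fun a ha h => hα (h ▸ ha)
  -- the dual parameters and the roots they carry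
  have hu' : ∀ i, (u i)⁻¹ * ((q : ℂ)⁻¹) ^ (m i - 1) ≠ 0 := fun i =>
    mul_ne_zero (inv_ne_zero (hu i)) (pow_ne_zero _ (inv_ne_zero hq0))
  have hroot : ∀ i, (q : ℂ) / ((u i)⁻¹ * ((q : ℂ)⁻¹) ^ (m i - 1)) = u i * (q : ℂ) ^ m i := by
    intro i
    obtain ⟨k, hk⟩ := Nat.exists_eq_add_of_le (hm i)
    rw [hk, Nat.add_sub_cancel_left, pow_add, pow_one, inv_pow]
    field_simp
  have hroota : ∀ a ∈ α, (q : ℂ) / a⁻¹ = (q : ℂ) * a := fun a _ => by rw [div_inv_eq_mul]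
  -- the two multisets of roots
  set A : Multiset ℂ := α + ∑ i, ({u i * (q : ℂ) ^ m i} : Multiset ℂ) with hA
  set B : Multiset ℂ := ∑ i, ({u i} : Multiset ℂ) + α.map ((q : ℂ) * ·) with hB
  have hA0 : (0 : ℂ) ∉ A := by
    intro h0
    rcases Multiset.mem_add.mp h0 with h1 | h1
    · exact hα h1
    · obtain ⟨i, -, hi⟩ := Multiset.mem_sum.mp h1
      rw [Multiset.mem_singleton] at hi
      exact mul_ne_zero (hu i) (pow_ne_zero _ hq0) hi.symm
  have hcard : Multiset.card B ≤ Multiset.card A := by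
    rw [hA, hB, Multiset.card_add, Multiset.card_add, Multiset.card_map]
    simp [Finset.card_univ, add_comm]
  -- the units absorbed into `Ψ` and `Φ`
  set Uψ : ℂ → ℂ := fun s => ∏ i, (-(((u i)⁻¹ * ((q : ℂ)⁻¹) ^ (m i - 1)) / q) * (q : ℂ) ^ s)
    with hUψ
  set Uφ : ℂ → ℂ := fun s => (α.map fun a => -(a⁻¹ / q) * (q : ℂ) ^ s).prod with hUφ
  have hUψc : Continuous Uψ :=
    continuous_finsetProd _ fun i _ => continuous_neg_div_mul_cpow hqpos _
  have hUφc : Continuous Uφ :=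
    continuous_multiset_prod _ fun a _ => continuous_neg_div_mul_cpow hqpos _
  have hUφ0 : ∀ s, Uφ s ≠ 0 := fun s => by
    rw [hUφ]
    exact Multiset.prod_ne_zero fun h0 => by
      obtain ⟨a, ha, h1⟩ := Multiset.mem_map.mp h0
      exact neg_div_mul_cpow_ne_zero hqpos (inv_ne_zero (ha0 a ha)) s h1
  -- the identity in peeled form
  have hdualP : ∀ s : ℂ, ∏ i, (1 - (u i)⁻¹ * ((q : ℂ)⁻¹) ^ (m i - 1) * (q : ℂ) ^ (-(1 - s))) =
      Uψ s * ((∑ i, ({u i * (q : ℂ) ^ m i} : Multiset ℂ)).map fun z => eulerTerm q z s).prod := by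
    intro s
    rw [prod_map_sum_singleton_eulerTerm, hUψ]
    simp only
    rw [← Finset.prod_mul_distrib]
    refine Finset.prod_congr rfl fun i _ => ?_
    rw [one_sub_mul_cpow_neg_one_sub hqpos (hu' i), hroot i]
  have hdualπ : ∀ s : ℂ, (α.map fun a => 1 - a⁻¹ * (q : ℂ) ^ (-(1 - s))).prod =
      Uφ s * ((α.map ((q : ℂ) * ·)).map fun z => eulerTerm q z s).prod := by
    intro s
    rw [hUφ, Multiset.map_map, ← Multiset.prod_map_mul]
    refine congrArg Multiset.prod (Multiset.map_congr rfl fun a ha => ?_)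
    rw [one_sub_mul_cpow_neg_one_sub hqpos (inv_ne_zero (ha0 a ha)), Function.comp_apply,
      div_inv_eq_mul]
  have hid' : ∀ s, s ∉ E → (Ψ s * Uψ s) * (A.map fun z => eulerTerm q z s).prod =
      (Φ s * Uφ s) * (B.map fun z => eulerTerm q z s).prod := by
    intro s hs
    have h := hid s hs
    rw [hdualP s, hdualπ s, prod_map_sum_singleton_eulerTerm] at h
    rw [hA, hB, Multiset.map_add, Multiset.prod_add, Multiset.map_add, Multiset.prod_add,
      prod_map_sum_singleton_eulerTerm, prod_map_sum_singleton_eulerTerm]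
    linear_combination h
  -- peel
  have hBA : B = A :=
    multiset_eq_of_eulerTerm_identity hq hEc (hΦc.mul hUφc.continuousOn)
      (fun s hs => mul_ne_zero (hΦ s hs) (hUφ0 s)) A B (fun s => Ψ s * Uψ s) hA0 hcard
      (fun z hz => hEfin z fun h => hA0 (h ▸ hz)) (hΨc.mul hUψc.continuousOn) hid'
  -- conclude
  refine blocks_trivial_of_multiset_eq hq1 hα hgen u m hu hm ?_
  rw [← hA, ← hBA, hB, add_comm]

end RamifiedClause

end Summit.Langlands.Langlands.Theorems.SkinnerWilesDefectOne.StrongLiftingAllFinite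

end
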